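import Summits.BirchSwinnertonDyer.BirchSwinnertonDyer.Theses.TameQuarticManinParity
import Summits.BirchSwinnertonDyer.BirchSwinnertonDyer.Theorems.TameQuarticManinParityCellsOfCDT
import HarnessLib

/-!
# Crux `TprimeReducibleManinUnit` (stmt-BirchSwinnertonDyer-23737) — reshape CANDIDATE v3-cdt
# (leafhand-bsd-tamequarticmaninpa-2 g0; scratch under `Cruxes/TprimeReducibleManinUnit/leafhand-2/`, NOT registered)

One-stub skeleton naming the crux's EXACT open content on the CDT road. The landed, kernel-checked conditional
closure `TameQuarticManinParityOfCDT.tprimeReducibleManinUnit_of_CDT` (p769891, cell bsd-wall / bsd-f2-manin road: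
Unbounded Denominators ⟹ `Λ₁(f) ⊆ Λ_W` ⟹ `|c₀| = 1` at every level with an odd `p² ∣ N`) proves the crux decl BY NAME
from the single cite-only PRINTED fact
`Literature.NumberTheory.Automorphic.CalegariDimitrovTang2025_unboundedDenominators_algInt`
(Calegari–Dimitrov–Tang, J. Amer. Math. Soc. 38 (2025), Thm. 1; statement only in the tree, no `_holds`).

Compared with the registered birth skeleton dd6798d6b59406a8 (stubs `stub_cesnaviciusNeururerSaha` = ČNS Thm 1.2 print
fact, `stub_tprimeRed_of_three_dvd_modularDegree` = open crux 24627) this candidate has ONE stub and that stub is a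
PRINT named fact: the item is print-blocked (director-bsd (685)(c)), not prover work, until either a `_holds` for CDT
lands (XL Literature formalisation) or the human gate on «UBD ⟹ Manin» (21-frontier R2, NEEDS HUMAN (G)) rules the
road out — in which case the birth skeleton's research stub 24627 (pen bsd-idea-3 LINES 45–71) is the live content.
HONEST LABEL: CONDITIONAL display only; the item stays OPEN; Manin's conjecture is not proved; BSD is proved for no curve.
-/

set_option autoImplicit false
-- D-0017: single-problem summit, `Summit.BirchSwinnertonDyer.BirchSwinnertonDyer.…` repeats a namespace by design.
set_option linter.dupNamespace false

noncomputable section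

namespace Summit.BirchSwinnertonDyer.BirchSwinnertonDyer.Cruxes.TprimeReducibleManinUnit.LeafhandTwo

open Summit.BirchSwinnertonDyer.BirchSwinnertonDyer.Theses.TameQuarticManinParity

/-- STUB (the crux's entire open content on the CDT road): the printed Unbounded Denominators theorem,
Calegari–Dimitrov–Tang 2025 Thm. 1 (algebraic-integer form), a cite-only `def … : Prop` of the Literature library
awaiting its `_holds` (XL formalisation). [cite: CalegariDimitrovTang2025, Thm. 1 and Remarks 58–59] -/
theorem stub_calegariDimitrovTang :
    Literature.NumberTheory.Automorphic.CalegariDimitrovTang2025_unboundedDenominators_algInt := by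
  sorry

/-- **The crux by name, modulo the one stub**, through the landed conditional closure
`TameQuarticManinParityOfCDT.tprimeReducibleManinUnit_of_CDT` (p769891). [folklore] -/
theorem TprimeReducibleManinUnit_of : TprimeReducibleManinUnit :=
  Summit.BirchSwinnertonDyer.BirchSwinnertonDyer.Theorems.TameQuarticManinParityOfCDT.tprimeReducibleManinUnit_of_CDT
    stub_calegariDimitrovTang

end Summit.BirchSwinnertonDyer.BirchSwinnertonDyer.Cruxes.TprimeReducibleManinUnit.LeafhandTwo

end
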